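import Literature.NumberTheory.Sieve.AsymptoticSieveForPrimesT
import Literature.NumberTheory.Sieve.AsymptoticSieveForPrimesS3Assembly
import Literature.NumberTheory.Sieve.AsymptoticSieveForPrimesAssemblyInputs
import Literature.NumberTheory.Sieve.AsymptoticSieveForPrimesLogSumIdentity
import HarnessLib

/-!
# Asymptotic sieve for primes: Theorem 1 in the `δ = (log x)^α, Δ = x^θ` regime, from FI (2.4) (proof)

Trunk T-SIEVE. Source: J. Friedlander, H. Iwaniec, *Asymptotic sieve for primes*, Ann. of Math. 148
(1998) 1041–1065 [FriedlanderIwaniecASP1998] (= arXiv:math/9811186), Theorem 1 (1.17) with the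
"In practice" regime of p. 1044 ("for `δ = (log x)^α`, `Δ = x^η` … (1.17) becomes
`∑_{p ≤ x} a_p log p = HA(x){1 + O(log log x / log x)}`"), and §8 p. 1058: "Combining (3.4), (3.5),
(4.5), (5.1), (6.6), (7.2) and (8.5) we complete the proof of Theorem 1."

This file closes the series `…AsymptoticSieveForPrimes{Inputs, Decomposition, DecompositionProofs,
Reduction, BilinearStrong, Assembly, Proofs, Brun, Tyz, T, S1, S2, S3Minus, S3Plus, S3Assembly,
AssemblyInputs, LogSums, LogSumIdentity}`: the corrected statement
`Literature.NumberTheory.Sieve.fi_asymptotic_sieve_primes_loglog` (`…AsymptoticSieveForPrimes`; the literal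
`Literature.NumberTheory.Sieve.fi_asymptotic_sieve_primes`, quantifying over all `δ, Δ ≥ 2`, is false as recorded there) is
PROVED from exactly ONE named fact of `…Inputs`, of prime-number-theorem strength:
* `fi_moebius_density_cancellation` — FI (2.4), `∑_{d ≤ y, (d,ν)=1} μ(d)g(d) ≪ σ_ν (log y)^{-6}`,
  whose printed proof (pp. 1048–1049) uses "a standard contour integration using the bound for the
  corresponding zeta function" (a zero-free region for `∏_p (1 - g(p)p^{-s})⁻¹`).
Everything else in FI's proof — Brun's upper-bound sieve weights (`…Brun`), (R) ⟹ (R′),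
(B) ⟹ (B′) (with the saving they carry), the identity (3.1)/(3.4), the sandwich (3.5), `H > 0`,
(1.13)–(1.14) from (2.4) (`…LogSumIdentity`), the sieve-density class of `gh`, and the five
estimates (4.5), (5.1), (6.6), (7.2), (8.5) — is proved in the files listed ((4.5), (5.1), (8.5)
modulo (2.4) where FI use it), and `fi_asymptotic_sieve_primes_loglog_of_inputs` (`…AssemblyInputs`)
combines them.

* `fi_asymptotic_sieve_primes_loglog_of_facts :
    fi_moebius_density_cancellation → fi_moebius_density_log_sum → fi_asymptotic_sieve_primes_loglog`;
* `fi_asymptotic_sieve_primes_loglog_of_cancellation :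
    fi_moebius_density_cancellation → fi_asymptotic_sieve_primes_loglog`;
* `SieveSequence.FIAsymptoticSieveHypotheses.isEquivalent_sum_primes_of_cancellation` — the
  corollary `∑_{p ≤ x} a_p log p ~ H A(x)` (from (2.4)).

## Mathlib search

The tree: `fi_asymptotic_sieve_primes_loglog_of_inputs` (`…AssemblyInputs`, from
`fi_asymptotic_sieve_primes_loglog_of_estimates`, `brun_upperSieveWeights_holds`,
`fi_sieve_density_admissible_holds`, `fi_densityConstant_pos_holds`,
`fi_asp_Tyz_estimate_of_cancellation`, `fi_asp_S1_estimate_holds`, `fi_asp_S2_estimate_holds`),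
`fi_asp_T_estimate_of_cancellation` (`…T`), `fi_asp_S3_estimate_of_cancellation` (`…S3Assembly`),
`fi_moebius_density_log_sum_of_cancellation` (`…LogSumIdentity`).
`lean search 'fi_asymptotic_sieve_primes_loglog'`: the Decomposition/Assembly/AssemblyInputs files
and the named fact; no unconditional proof in the tree.
-/

noncomputable section

namespace Literature.NumberTheory.Sieve

/-- **Friedlander–Iwaniec, Theorem 1, in the regime `δ = (log x)^α`, `Δ = x^θ` (`0 < θ < 1/3`)**,
from FI (2.4) and FI (1.13)–(1.14): under the hypotheses of
Theorem 1 for these parameter functions, `∑_{p ≤ x} a_p log p - H A(x) = O(H A(x) log log x / log x)`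
(FI p. 1044: "(1.17) becomes `∑_{p≤x} a_p log p = HA(x){1 + O(log log x/log x)}`"; §8 p. 1058:
"Combining (3.4), (3.5), (4.5), (5.1), (6.6), (7.2) and (8.5) we complete the proof of Theorem 1").
[cite: FriedlanderIwaniecASP1998, Thm 1 (1.17) and p. 1044] -/
theorem fi_asymptotic_sieve_primes_loglog_of_facts (h24 : fi_moebius_density_cancellation)
    (h13 : fi_moebius_density_log_sum) : fi_asymptotic_sieve_primes_loglog :=
  fi_asymptotic_sieve_primes_loglog_of_inputs h24 (fi_asp_T_estimate_of_cancellation h24 h13)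
    (fi_asp_S3_estimate_of_cancellation h24)

/-- **Friedlander–Iwaniec, Theorem 1, in the regime `δ = (log x)^α`, `Δ = x^θ` (`0 < θ < 1/3`)**,
from the single named fact FI (2.4) (`fi_moebius_density_cancellation`; FI (1.13)–(1.14) is derived
from it in `…LogSumIdentity`). [cite: FriedlanderIwaniecASP1998, Thm 1 (1.17), p. 1044 and (2.4)] -/
theorem fi_asymptotic_sieve_primes_loglog_of_cancellation (h24 : fi_moebius_density_cancellation) :
    fi_asymptotic_sieve_primes_loglog :=
  fi_asymptotic_sieve_primes_loglog_of_facts h24 (fi_moebius_density_log_sum_of_cancellation h24)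

open Filter Asymptotics Topology in
/-- **Corollary: `∑_{p ≤ x} a_p log p ~ H A(x)`** in the regime `δ = (log x)^α`, `Δ = x^θ`
(`0 < θ < 1/3`), from FI (2.4): the relative error `O(log log x / log x)` tends to `0`.
[cite: FriedlanderIwaniecASP1998, Thm 1 (1.17) and p. 1044] -/
theorem SieveSequence.FIAsymptoticSieveHypotheses.isEquivalent_sum_primes_of_cancellation
    (h24 : fi_moebius_density_cancellation) {A : SieveSequence} {D : ℝ → ℝ} {α θ H : ℝ}
    (hα : 0 < α) (hθ : 0 < θ) (hθ3 : θ < 1 / 3)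
    (hhyp : A.FIAsymptoticSieveHypotheses D (fun x => Real.log x ^ α) (fun x => x ^ θ))
    (hH : A.HasDensityConstant H) :
    (fun x : ℝ => ∑ p ∈ Nat.primesLE ⌊x⌋₊, A.a p * Real.log p) ~[atTop]
      fun x : ℝ => H * A.size x := by
  have h := fi_asymptotic_sieve_primes_loglog_of_cancellation h24 A D α θ H hα hθ hθ3 hhyp hH
  have hr : Tendsto (fun x : ℝ => Real.log (Real.log x) / Real.log x) atTop (𝓝 0) := by
    have := (Real.isLittleO_log_id_atTop.comp_tendsto Real.tendsto_log_atTop).tendsto_div_nhds_zero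
    simpa only [Function.comp_def, id_eq] using this
  have hsmall : (fun x : ℝ => H * A.size x * (Real.log (Real.log x) / Real.log x)) =o[atTop]
      fun x : ℝ => H * A.size x := by
    have h1 := (isBigO_refl (fun x : ℝ => H * A.size x) atTop).mul_isLittleO
      ((isLittleO_one_iff ℝ).2 hr)
    simpa only [mul_one] using h1
  exact h.trans_isLittleO hsmall

end Literature.NumberTheory.Sieve
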